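import Summits.BirchSwinnertonDyer.BirchSwinnertonDyer.Theorems.AdditiveKolyvaginRoadAdmissibleJumpTransverse
import Summits.BirchSwinnertonDyer.BirchSwinnertonDyer.Theorems.AdditiveKolyvaginRoadAdmissibleRelaxedTransverse
import HarnessLib

/-!
# Route `AdditiveKolyvaginRoad`, crux `LevelKolyvaginSystemsAdditive` (item stmt-BirchSwinnertonDyer-21396, KS′):
# binder (A²) of the synthetic level Kolyvagin system — the TWO-STEP ADMISSIBLE LOWERING for the level Selmer spaces
# TRANSVERSE on `m`, FROM THE POITOU–TATE FACT
# (cell `pub/bsd-wall`, width seat `bsd-wall-akr-p2x-w5` g0; `--supports stmt-BirchSwinnertonDyer-21396`, helper;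
# discharges binder `hTwoStep` of `nonempty_levelKolyvaginSystemP_of_selmerDichotomy`, p624424)

WHAT. `selmerDichotomy_twoStep_of_poitouTate`: for `K` imaginary quadratic with `d_K < −4`, `p` odd, complex
conjugation `c ≠ 1`, the named fact `poitouTate_selmerStructure_duality K`, and ANY family `𝒮 n m μ ≤ H¹(K, E[p])` with
the membership dictionary of the level-`n` `μ`-eigen Selmer space of `E[p]` transverse on the Kolyvagin primes of `m`
(automatically finite-dimensional, `moduleFinite_of_levelDictionary`): for admissible `q₁ ∉ n`, `q₂ ∉ n ∪ {q₁}`, if the TOTAL rank `dim 𝒮⁺ + dim 𝒮⁻` at the level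
`n'' = n ∪ {q₁, q₂}` is `1` and some class of `𝒮 n'' m μ` is NOT locally trivial above `q₂`, then the total rank at the
level `n` is `1` — literally the binder `hTwoStep` (W. Zhang's Lemma 5.3 ∕ Prop. 5.4 shape, read through
«`κ ≠ 0 ⟺` total rank one»).

PROOF (E-side Selmer algebra at the two admissible places; `n' = n ∪ {q₁}`, `w₁ ∋ q₁`, `v₂ ∋ q₂`).
Tools (sibling `…AdmissibleRelaxedTransverse`): for classes of the level structure RELAXED at an admissible place `w`
(Kummer at `∞` and off `w ∪ m ∪ level`, toric above the level, transverse above `m`) — (Stab) under `c_*`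
(`conjAct_mem_relaxedTransverseAt`), (HYP) the hyperbolic dichotomy «Kummer or toric at `w`» from Poitou–Tate
reciprocity + isotropies (`mem_selmerLocalKer_or_mem_toricLocalKer_of_relaxedTransverse`), and (Trans) `H¹_f ∩ H¹_tor = 0`
(`mem_torsionLocalKer_of_selmer_of_toric_admQ`). STEP A (at `v₂`): for `x ∈ 𝒮 n' m μ'` (Kummer at
`v₂`) and the given `g ∈ 𝒮 n'' m μ` (toric, `loc g ≠ 0`), `x + g` is Kummer or toric at `v₂`; Kummer would make `g`
Kummer-and-toric, so `x` is toric-and-Kummer, i.e. `loc_{v₂} x = 0`, whence `x ∈ 𝒮 n'' m μ' ∩ ker loc_{v₂}`; at total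
rank one with `g ∉ ker loc_{v₂}` that intersection is `0` for both signs: `𝒮 n' m = 0`. STEP B (at `w₁`): the JUMP
`exists_relaxedTransverse_notMem_torsionLocalKer_of_admQ` (sibling file) gives a relaxed class `x` with `loc_{w₁} x ≠ 0`;
its eigen-components are relaxed ((Stab): `conjAct` transports every clause), the one of the wrong sign is locally trivial
(`localEquiv_of_admQ`, W. Zhang (9.2)), so the `ε_{q₁}`-component `x_s` has `loc ≠ 0`, is Kummer or toric by (HYP),
not toric (it would lie in `𝒮 n' m s = 0`), hence `x_s ∈ 𝒮 n m s ∖ 0`; conversely `𝒮 n m s ∩ ker loc_{w₁} ⊆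
𝒮 n' m s = 0` and `loc_{w₁}(𝒮 n m s)` lies in the Kummer line (`#F = p`, `natCard_kummer_eq_of_admQ`), so
`𝒮 n m s = 𝔽_p · x_s`, while `𝒮 n m ¬s ⊆ ker loc_{w₁}` vanishes. Total rank one.

HONEST FRAMING: one theorem; 0 definitions, 0 named facts, 0 `sorry`; CONDITIONAL on the named PT fact (the route's
DUAL-type input, as for (Supply) ∕ (K)); closes nothing. With (K)-(Lower) (`selmerDichotomy_lower_of_localPackage`) and
(K)-(Raise) this discharges the E-side binders of the lead's synthetic system; KS′ and KPA′ stay OPEN at `p² ∣ N`. BSD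
is not proved by any of this.

References: [cite: WZhang2014, Lemma 5.1, Lemma 5.3, Prop. 5.4, §8.1, §9 (9.2)] [cite: BertoliniDarmon2005,
§2.2–§2.3, Lemma 2.6] [cite: MilneADT2006, Ch. I, Cor. 2.3, Thm. 2.8, Thm. 4.10] [cite: GrossLMS1991, §5 (5.1)]
[cite: McCallumLMS1991, Prop. 2.1] [cite: PoonenRains2012, Prop. 4.10].
-/

-- single-conjunct summit: `Summit.BirchSwinnertonDyer.BirchSwinnertonDyer.…` repeats the name by design
set_option linter.dupNamespace false

noncomputable section

open scoped Classical NumberField Pointwise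
open Function NumberField IsDedekindDomain Field WeierstrassCurve
open Literature.NumberTheory.EllipticCurves Literature.NumberTheory.EllipticCurves.ModularForms
open Literature.NumberTheory.GaloisRepresentations Literature.NumberTheory.GaloisRepresentations.DiscreteGaloisModule
  Literature.NumberTheory.GaloisCohomology Module
open Summit.BirchSwinnertonDyer.Rank1Residual.X11b.FiniteDuality
open Summit.BirchSwinnertonDyer.Rank1Residual.X11b.Relaxation
open Summit.BirchSwinnertonDyer.Rank1Residual.X11b
open Summit.BirchSwinnertonDyer.Rank1Residual.GaloisImage
open Summit.BirchSwinnertonDyer.Rank1Residual.X11b.Three.Koly.Method2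
open Summit.BirchSwinnertonDyer.Rank1Residual.X11b.Three.Koly.ZhangSupply.LocalConj
open Literature.NumberTheory.Automorphic

namespace Summit.BirchSwinnertonDyer.BirchSwinnertonDyer.Theorems.AdditiveKoly

variable (W : WeierstrassCurve ℚ) (K : Type) [Field K] [NumberField K] (p : ℕ) [W.IsElliptic] [W.IsGloballyMinimal]
  [Fact p.Prime] (ι : K →+* ℂ) (c : K ≃ₐ[ℚ] K) [Module (ZMod p) (Vp W K p)]
  -- cup products need the compactness of the local absolute Galois groups (binder, discharged by
  -- `absoluteGaloisGroup_compactSpace` at the call site)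
  [∀ v : Place K, CompactSpace (absoluteGaloisGroup (Place.Completion v))]

-- two admissible places, a jump, an eigen-decomposition and two hyperbolic dichotomies over a large context
set_option maxHeartbeats 400000 in
/-- **(A²) the TWO-STEP ADMISSIBLE LOWERING for the level spaces transverse on `m`, from Poitou–Tate** — the binder
`hTwoStep` of `nonempty_levelKolyvaginSystemP_of_selmerDichotomy`. `K` imaginary quadratic with `d_K < −4`, `p` odd,
`c ≠ 1`, the named PT fact; `𝒮` any family with the membership dictionary (finite-dimensional by
`moduleFinite_of_levelDictionary`). For `q₁ ∉ n`,
`q₂ ∉ n ∪ {q₁}`: total rank one at `n ∪ {q₁, q₂}` with a class of `𝒮 (n ∪ {q₁,q₂}) m μ` not locally trivial above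
`q₂` ⟹ total rank one at `n`. STEP A: `𝒮 (n ∪ {q₁}) m = 0` (reciprocity + hyperbolic dichotomy at the place of `q₂`);
STEP B: the jump at the place of `q₁`, sign bookkeeping (9.2), dichotomy, and the Kummer line of order `p`.
[cite: WZhang2014, Lemma 5.3, Prop. 5.4, §9 (9.2)] [cite: BertoliniDarmon2005, Lemma 2.6]
[cite: MilneADT2006, Ch. I, Thm. 4.10] -/
theorem selmerDichotomy_twoStep_of_poitouTate (hK : IsImaginaryQuadratic K) (hp2 : p ≠ 2)
    (hd : NumberField.discr K < -4) (hc1 : c ≠ 1) (hPT : poitouTate_selmerStructure_duality K)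
    (𝒮 : Finset (AdmQ W K p) → Finset {ℓ // Zhang2014.IsKolyvaginPrime (W.conductorNorm ℤ) W K p ℓ} → Bool →
      Submodule (ZMod p) (Vp W K p))
    (h𝒮 : ∀ (n : Finset (AdmQ W K p)) (m : Finset {ℓ // Zhang2014.IsKolyvaginPrime (W.conductorNorm ℤ) W K p ℓ})
      (μ : Bool) (x : Vp W K p), x ∈ 𝒮 n m μ ↔
        conjAct W c ((p ^ 1 : ℕ) : ℤ) x = sgnP μ • x ∧
        (∀ w : InfinitePlace K, x ∈ selmerLocalKer (W.baseChange K) w.Completion ((p ^ 1 : ℕ) : ℤ)) ∧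
        (∀ v : HeightOneSpectrum (𝓞 K), (∀ ℓ ∈ m, ((ℓ : ℕ) : 𝓞 K) ∉ v.asIdeal) → (∀ q ∈ n, ((q : ℕ) : 𝓞 K) ∉ v.asIdeal) →
          x ∈ selmerLocalKer (W.baseChange K) (v.adicCompletion K) ((p ^ 1 : ℕ) : ℤ)) ∧
        (∀ q ∈ n, ∀ v : HeightOneSpectrum (𝓞 K), ((q : ℕ) : 𝓞 K) ∈ v.asIdeal →
          x ∈ toricLocalKer (W.baseChange K) (v.adicCompletion K) ((p ^ 1 : ℕ) : ℤ)) ∧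
        (∀ ℓ ∈ m, ∀ v : HeightOneSpectrum (𝓞 K), ((ℓ : ℕ) : 𝓞 K) ∈ v.asIdeal → x ∈ transverseLocalKerP W K p ι ℓ v)) :
    ∀ (n : Finset (AdmQ W K p)) (q₁ q₂ : AdmQ W K p), n.Nonempty → Even n.card → q₁ ∉ n → q₂ ∉ insert q₁ n →
      ∀ (m : Finset {ℓ // Zhang2014.IsKolyvaginPrime (W.conductorNorm ℤ) W K p ℓ}) (μ : Bool),
        finrank (ZMod p) (𝒮 (insert q₂ (insert q₁ n)) m true) +
            finrank (ZMod p) (𝒮 (insert q₂ (insert q₁ n)) m false) = 1 →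
        (∃ g ∈ 𝒮 (insert q₂ (insert q₁ n)) m μ, ∃ v : HeightOneSpectrum (𝓞 K), ((q₂ : ℕ) : 𝓞 K) ∈ v.asIdeal ∧
          g ∉ (W.baseChange K).torsionLocalKer (v.adicCompletion K) ((p ^ 1 : ℕ) : ℤ)) →
        finrank (ZMod p) (𝒮 n m true) + finrank (ZMod p) (𝒮 n m false) = 1 := by
  intro n q₁ q₂ _ _ hq₁ hq₂ m μ h1 hg
  obtain ⟨g, hg, v₂, hv₂, hgv₂⟩ := hg
  have hfin := moduleFinite_of_levelDictionary W K p ι c 𝒮 h𝒮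
  have hp : p.Prime := Fact.out
  haveI : NeZero (p ^ 1 : ℕ) := ⟨pow_ne_zero 1 hp.ne_zero⟩
  haveI : IsTotallyComplex K := hK.2
  have hK2 : Module.finrank ℚ K = 2 := hK.1
  have hcc : c * c = 1 := algEquiv_mul_self_eq_one K hK c
  set τ := conjAct W c ((p ^ 1 : ℕ) : ℤ) with hτ
  have hττ : ∀ y : Vp W K p, τ (τ y) = y := fun y ↦ conjAct_conjAct_of_mul_self W hcc ((p ^ 1 : ℕ) : ℤ) y
  /- §0 places: uniqueness above an inert admissible prime, separation, the place `w₁` of `q₁` -/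
  have huniq : ∀ (q : AdmQ W K p) (v v' : HeightOneSpectrum (𝓞 K)), ((q : ℕ) : 𝓞 K) ∈ v.asIdeal →
      ((q : ℕ) : 𝓞 K) ∈ v'.asIdeal → v' = v :=
    fun q v v' hv hv' ↦ (mem_asIdeal_iff_eq_of_admQ W K p q v hv v').mp hv'
  have hsep : ∀ (q q' : AdmQ W K p) (v : HeightOneSpectrum (𝓞 K)), q ≠ q' → ((q : ℕ) : 𝓞 K) ∈ v.asIdeal →
      ((q' : ℕ) : 𝓞 K) ∉ v.asIdeal := by
    intro q q' v hne hqv hq'v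
    have hcop : Nat.Coprime (q : ℕ) (q' : ℕ) := (Nat.coprime_primes q.2.1 q'.2.1).mpr (fun h ↦ hne (Subtype.ext h))
    exact not_mem_asIdeal_of_coprime K hcop v hqv hq'v
  have hsepK : ∀ (q : AdmQ W K p) (ℓ : {ℓ // Zhang2014.IsKolyvaginPrime (W.conductorNorm ℤ) W K p ℓ})
      (v : HeightOneSpectrum (𝓞 K)), ((q : ℕ) : 𝓞 K) ∈ v.asIdeal → ((ℓ : ℕ) : 𝓞 K) ∉ v.asIdeal :=
    fun q ℓ v hqv hℓv ↦ not_mem_of_kolyvagin_place_P W K p q ℓ.2 v hℓv hqv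
  let w₁ : HeightOneSpectrum (𝓞 K) := ⟨Ideal.span {((q₁ : ℕ) : 𝓞 K)}, q₁.2.2.2.1, by
    rw [Ne, Ideal.span_singleton_eq_bot]; exact_mod_cast q₁.2.1.ne_zero⟩
  have hw₁ : ((q₁ : ℕ) : 𝓞 K) ∈ w₁.asIdeal := Ideal.mem_span_singleton_self _
  /- §1 the level structure (toric above `N`, transverse above `m`, Kummer elsewhere) RELAXED at a place `w` -/
  set R : Finset (AdmQ W K p) → HeightOneSpectrum (𝓞 K) → Vp W K p → Prop := fun N w x ↦
    (∀ u : InfinitePlace K, x ∈ selmerLocalKer (W.baseChange K) u.Completion ((p ^ 1 : ℕ) : ℤ)) ∧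
    (∀ v : HeightOneSpectrum (𝓞 K), v ≠ w → (∀ ℓ ∈ m, ((ℓ : ℕ) : 𝓞 K) ∉ v.asIdeal) →
      (∀ q ∈ N, ((q : ℕ) : 𝓞 K) ∉ v.asIdeal) →
        x ∈ selmerLocalKer (W.baseChange K) (v.adicCompletion K) ((p ^ 1 : ℕ) : ℤ)) ∧
    (∀ q ∈ N, ∀ v : HeightOneSpectrum (𝓞 K), ((q : ℕ) : 𝓞 K) ∈ v.asIdeal →
        x ∈ toricLocalKer (W.baseChange K) (v.adicCompletion K) ((p ^ 1 : ℕ) : ℤ)) ∧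
    (∀ ℓ ∈ m, ∀ v : HeightOneSpectrum (𝓞 K), ((ℓ : ℕ) : 𝓞 K) ∈ v.asIdeal → x ∈ transverseLocalKerP W K p ι ℓ v)
    with hR
  have hRS : ∀ N w μ' x, x ∈ 𝒮 N m μ' → R N w x := fun N w μ' x hx ↦ by
    obtain ⟨-, hinf, hoff, htor, htr⟩ := (h𝒮 N m μ' x).mp hx
    exact ⟨hinf, fun v _ hvm hvN ↦ hoff v hvm hvN, htor, htr⟩
  have hRS' : ∀ N (q : AdmQ W K p) w μ' x, ((q : ℕ) : 𝓞 K) ∈ w.asIdeal → x ∈ 𝒮 (insert q N) m μ' → R N w x := by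
    intro N q w μ' x hqw hx
    obtain ⟨-, hinf, hoff, htor, htr⟩ := (h𝒮 (insert q N) m μ' x).mp hx
    refine ⟨hinf, fun v hvw hvm hvN ↦ hoff v hvm (fun q' hq' ↦ ?_),
      fun q' hq' v hv ↦ htor q' (Finset.mem_insert_of_mem hq') v hv, htr⟩
    rcases Finset.mem_insert.mp hq' with rfl | hq'
    · exact fun h ↦ hvw (huniq _ w v hqw h)
    · exact hvN q' hq'
  have hRadd : ∀ N w x y, R N w x → R N w y → R N w (x + y) := fun N w x y hx hy ↦
    ⟨fun u ↦ add_mem (hx.1 u) (hy.1 u), fun v hv hvm hvN ↦ add_mem (hx.2.1 v hv hvm hvN) (hy.2.1 v hv hvm hvN),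
      fun q hq v hv ↦ add_mem (hx.2.2.1 q hq v hv) (hy.2.2.1 q hq v hv),
      fun ℓ hℓ v hv ↦ add_mem (hx.2.2.2 ℓ hℓ v hv) (hy.2.2.2 ℓ hℓ v hv)⟩
  have hRsub : ∀ N w x y, R N w x → R N w y → R N w (x - y) := fun N w x y hx hy ↦
    ⟨fun u ↦ sub_mem (hx.1 u) (hy.1 u), fun v hv hvm hvN ↦ sub_mem (hx.2.1 v hv hvm hvN) (hy.2.1 v hv hvm hvN),
      fun q hq v hv ↦ sub_mem (hx.2.2.1 q hq v hv) (hy.2.2.1 q hq v hv),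
      fun ℓ hℓ v hv ↦ sub_mem (hx.2.2.2 ℓ hℓ v hv) (hy.2.2.2 ℓ hℓ v hv)⟩
  have hRzsmul : ∀ N w (a : ℤ) x, R N w x → R N w (a • x) := fun N w a x hx ↦
    ⟨fun u ↦ AddSubgroup.zsmul_mem _ (hx.1 u) a, fun v hv hvm hvN ↦ AddSubgroup.zsmul_mem _ (hx.2.1 v hv hvm hvN) a,
      fun q hq v hv ↦ AddSubgroup.zsmul_mem _ (hx.2.2.1 q hq v hv) a,
      fun ℓ hℓ v hv ↦ AddSubgroup.zsmul_mem _ (hx.2.2.2 ℓ hℓ v hv) a⟩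
  -- (Stab), (Trans) and the hyperbolic dichotomy for the relaxed structure (`…AdmissibleRelaxedTransverse`)
  have hRτ : ∀ N (q : AdmQ W K p) w x, ((q : ℕ) : 𝓞 K) ∈ w.asIdeal → R N w x → R N w (τ x) :=
    fun N q w x hqw hx ↦ conjAct_mem_relaxedTransverseAt W K p ι c hK hc1 N m q w hqw x hx
  have hKT : ∀ (q : AdmQ W K p) (w : HeightOneSpectrum (𝓞 K)), ((q : ℕ) : 𝓞 K) ∈ w.asIdeal → ∀ z : Vp W K p,
      z ∈ selmerLocalKer (W.baseChange K) (w.adicCompletion K) ((p ^ 1 : ℕ) : ℤ) →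
      z ∈ toricLocalKer (W.baseChange K) (w.adicCompletion K) ((p ^ 1 : ℕ) : ℤ) →
      z ∈ (W.baseChange K).torsionLocalKer (w.adicCompletion K) ((p ^ 1 : ℕ) : ℤ) :=
    fun q w hqw z hzK hzT ↦ mem_torsionLocalKer_of_selmer_of_toric_admQ W K p q w hqw z hzK hzT
  have hdich : ∀ (N : Finset (AdmQ W K p)) (q : AdmQ W K p) (w : HeightOneSpectrum (𝓞 K)), q ∉ N →
      ((q : ℕ) : 𝓞 K) ∈ w.asIdeal → ∀ z : Vp W K p, R N w z →
      z ∈ selmerLocalKer (W.baseChange K) (w.adicCompletion K) ((p ^ 1 : ℕ) : ℤ) ∨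
        z ∈ toricLocalKer (W.baseChange K) (w.adicCompletion K) ((p ^ 1 : ℕ) : ℤ) :=
    fun N q w hqN hqw z hz ↦
      mem_selmerLocalKer_or_mem_toricLocalKer_of_relaxedTransverse W K p ι hK hp2 hPT N m q w hqN hqw z hz
  /- §2 STEP A: the level-`n ∪ {q₁}` spaces vanish -/
  let Z₂ : Submodule (ZMod p) (Vp W K p) :=
    AddSubgroup.toZModSubmodule p ((W.baseChange K).torsionLocalKer (v₂.adicCompletion K) ((p ^ 1 : ℕ) : ℤ))
  have hZ₂ : ∀ x, x ∈ Z₂ ↔ x ∈ (W.baseChange K).torsionLocalKer (v₂.adicCompletion K) ((p ^ 1 : ℕ) : ℤ) :=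
    fun x ↦ AddSubgroup.mem_toZModSubmodule p
  -- (A.1) every class of `𝒮 (n ∪ q₁) m μ'` is locally trivial at `v₂`
  have hA1 : ∀ μ' x, x ∈ 𝒮 (insert q₁ n) m μ' →
      x ∈ (W.baseChange K).torsionLocalKer (v₂.adicCompletion K) ((p ^ 1 : ℕ) : ℤ) := by
    intro μ' x hx
    have hv₂m : ∀ ℓ ∈ m, ((ℓ : ℕ) : 𝓞 K) ∉ v₂.asIdeal := fun ℓ _ ↦ hsepK q₂ ℓ v₂ hv₂
    have hv₂n' : ∀ q ∈ insert q₁ n, ((q : ℕ) : 𝓞 K) ∉ v₂.asIdeal :=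
      fun q hq ↦ hsep q₂ q v₂ (fun h ↦ hq₂ (h ▸ hq)) hv₂
    have hxK : x ∈ selmerLocalKer (W.baseChange K) (v₂.adicCompletion K) ((p ^ 1 : ℕ) : ℤ) :=
      ((h𝒮 _ m μ' x).mp hx).2.2.1 v₂ hv₂m hv₂n'
    have hgT : g ∈ toricLocalKer (W.baseChange K) (v₂.adicCompletion K) ((p ^ 1 : ℕ) : ℤ) :=
      ((h𝒮 _ m μ g).mp hg).2.2.2.1 q₂ (Finset.mem_insert_self _ _) v₂ hv₂
    have hxR : R (insert q₁ n) v₂ x := hRS _ v₂ μ' x hx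
    have hgR : R (insert q₁ n) v₂ g := hRS' _ q₂ v₂ μ g hv₂ hg
    rcases hdich _ q₂ v₂ hq₂ hv₂ (x + g) (hRadd _ _ x g hxR hgR) with hK' | hT'
    · -- `x + g` Kummer at `v₂`: then `g` is Kummer and toric there, so locally trivial — contradiction
      exfalso
      have hgK : g ∈ selmerLocalKer (W.baseChange K) (v₂.adicCompletion K) ((p ^ 1 : ℕ) : ℤ) := by
        have h := sub_mem hK' hxK
        rwa [add_sub_cancel_left] at h
      exact hgv₂ (hKT q₂ v₂ hv₂ g hgK hgT)
    · -- `x + g` toric at `v₂`: then `x` is Kummer and toric there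
      have hxT : x ∈ toricLocalKer (W.baseChange K) (v₂.adicCompletion K) ((p ^ 1 : ℕ) : ℤ) := by
        have h := sub_mem hT' hgT
        rwa [add_sub_cancel_right] at h
      exact hKT q₂ v₂ hv₂ x hxK hxT
  -- (A.2) hence `𝒮 (n ∪ q₁) m μ' ≤ 𝒮 (n ∪ q₁ ∪ q₂) m μ' ∩ ker loc_{v₂}`
  have hA2 : ∀ μ', 𝒮 (insert q₁ n) m μ' ≤ 𝒮 (insert q₂ (insert q₁ n)) m μ' ⊓ Z₂ := by
    intro μ' x hx
    have hx0 := hA1 μ' x hx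
    obtain ⟨hs, hinf, hoff, htor, htr⟩ := (h𝒮 _ m μ' x).mp hx
    refine Submodule.mem_inf.mpr ⟨(h𝒮 _ m μ' x).mpr ⟨hs, hinf,
      fun v hvm hvn ↦ hoff v hvm (fun q hq ↦ hvn q (Finset.mem_insert_of_mem hq)), fun q hq v hv ↦ ?_, htr⟩,
      (hZ₂ x).mpr hx0⟩
    rcases Finset.mem_insert.mp hq with rfl | hq
    · rw [huniq _ v₂ v hv₂ hv]
      exact torsionLocalKer_le_toricLocalKer W K _ _ hx0
    · exact htor q hq v hv
  -- (A.3) at total rank one with `g ∉ ker loc_{v₂}` that intersection vanishes for both signs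
  have hg0 : g ≠ 0 := fun h ↦ hgv₂ (by rw [h]; exact zero_mem _)
  have hge1 : 1 ≤ finrank (ZMod p) (𝒮 (insert q₂ (insert q₁ n)) m μ) := by
    haveI := hfin (insert q₂ (insert q₁ n)) m μ
    have hle : (ZMod p) ∙ g ≤ 𝒮 (insert q₂ (insert q₁ n)) m μ := (Submodule.span_singleton_le_iff_mem g _).mpr hg
    calc 1 = finrank (ZMod p) ((ZMod p) ∙ g) := (finrank_span_singleton hg0).symm
      _ ≤ _ := Submodule.finrank_mono hle
  have hrank1 : finrank (ZMod p) (𝒮 (insert q₂ (insert q₁ n)) m μ) = 1 := by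
    cases μ <;> omega
  have hrank0 : ∀ μ', μ' ≠ μ → finrank (ZMod p) (𝒮 (insert q₂ (insert q₁ n)) m μ') = 0 := by
    intro μ' hμ'
    cases μ <;> cases μ' <;> first | exact absurd rfl hμ' | omega
  have hA3 : ∀ μ', 𝒮 (insert q₂ (insert q₁ n)) m μ' ⊓ Z₂ = ⊥ := by
    intro μ'
    by_cases hμ' : μ' = μ
    · rw [hμ', Submodule.eq_bot_iff]
      intro x hx
      obtain ⟨hxS, hxZ⟩ := Submodule.mem_inf.mp hx
      by_contra hx0
      haveI := hfin (insert q₂ (insert q₁ n)) m μ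
      -- `x` spans the line `𝒮 n'' m μ`, so `g` is a multiple of `x`, hence locally trivial at `v₂`
      have hle : (ZMod p) ∙ x ≤ 𝒮 (insert q₂ (insert q₁ n)) m μ := (Submodule.span_singleton_le_iff_mem x _).mpr hxS
      have heq : (ZMod p) ∙ x = 𝒮 (insert q₂ (insert q₁ n)) m μ :=
        Submodule.eq_of_le_of_finrank_le hle (by rw [finrank_span_singleton hx0, hrank1])
      have hgx : g ∈ (ZMod p) ∙ x := by rw [heq]; exact hg
      obtain ⟨a, ha⟩ := Submodule.mem_span_singleton.mp hgx
      have hgZ : g ∈ Z₂ := ha ▸ Z₂.smul_mem a hxZ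
      exact hgv₂ ((hZ₂ g).mp hgZ)
    · haveI := hfin (insert q₂ (insert q₁ n)) m μ'
      have h0 : 𝒮 (insert q₂ (insert q₁ n)) m μ' = ⊥ := Submodule.finrank_eq_zero.mp (hrank0 μ' hμ')
      rw [h0, bot_inf_eq]
  have hA : ∀ μ', 𝒮 (insert q₁ n) m μ' = ⊥ := fun μ' ↦ le_bot_iff.mp ((hA2 μ').trans (hA3 μ').le)
  /- §3 STEP B: the jump at `w₁`, the sign, the dichotomy, the Kummer line -/
  -- classes of `𝒮 n m μ'` locally trivial at `w₁` lie in `𝒮 (n ∪ q₁) m μ' = 0`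
  have hB1 : ∀ μ' y, y ∈ 𝒮 n m μ' →
      y ∈ (W.baseChange K).torsionLocalKer (w₁.adicCompletion K) ((p ^ 1 : ℕ) : ℤ) → y = 0 := by
    intro μ' y hy hy0
    obtain ⟨hs, hinf, hoff, htor, htr⟩ := (h𝒮 n m μ' y).mp hy
    have hy' : y ∈ 𝒮 (insert q₁ n) m μ' := by
      refine (h𝒮 _ m μ' y).mpr ⟨hs, hinf,
        fun v hvm hvn ↦ hoff v hvm (fun q hq ↦ hvn q (Finset.mem_insert_of_mem hq)), fun q hq v hv ↦ ?_, htr⟩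
      rcases Finset.mem_insert.mp hq with rfl | hq
      · rw [huniq _ w₁ v hw₁ hv]
        exact torsionLocalKer_le_toricLocalKer W K _ _ hy0
      · exact htor q hq v hv
    rw [hA μ'] at hy'
    exact (Submodule.mem_bot (ZMod p)).mp hy'
  -- the sign `s₁ = ε_{q₁}`: classes of the other sign are locally trivial at `w₁` (W. Zhang (9.2))
  obtain ⟨s₁, hs₁⟩ := localEquiv_of_admQ W K p hK2 hc1 q₁
  set locv := (W.baseChange K).torsionLocMap (w₁.adicCompletion K) ((p ^ 1 : ℕ) : ℤ) with hlocv
  have hNodd : Odd (((p ^ 1 : ℕ) : ℤ)) := by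
    rw [pow_one]; exact_mod_cast hp.odd_of_ne_two hp2
  have hNloc : ∀ y : Vp W K p, ((p ^ 1 : ℕ) : ℤ) • locv y = 0 := fun y ↦ zsmul_discreteH1_torsion ((p ^ 1 : ℕ) : ℤ) _
  have hwrong : ∀ (μ' : Bool) (y : Vp W K p), μ' ≠ s₁ → τ y = sgnP μ' • y →
      y ∈ (W.baseChange K).torsionLocalKer (w₁.adicCompletion K) ((p ^ 1 : ℕ) : ℤ) := by
    intro μ' y hne hy
    exact AddMonoidHom.mem_ker.mpr (loc_eq_zero_of_sign_ne_odd τ locv (hs₁ w₁ hw₁) hy (Ne.symm hne) hNodd (hNloc y))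
  have hB2 : ∀ μ', μ' ≠ s₁ → 𝒮 n m μ' = ⊥ := by
    intro μ' hne
    rw [Submodule.eq_bot_iff]
    intro y hy
    exact hB1 μ' y hy (hwrong μ' y hne ((h𝒮 n m μ' y).mp hy).1)
  -- the jump at `w₁` and its eigen-components
  obtain ⟨x, hxinf, hxoff, hxtor, hxtr, hxw₁⟩ :=
    exists_relaxedTransverse_notMem_torsionLocalKer_of_admQ W K p hK hp2 hd hPT ι n m q₁ w₁ hq₁ hw₁
  have hxR : R n w₁ x := ⟨hxinf, hxoff, hxtor, hxtr⟩
  obtain ⟨u, hu⟩ := exists_two_mul_zsmul_eq_of_odd W K p (hp.odd_of_ne_two hp2)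
  set xp := u • (x + τ x) with hxp
  set xm := u • (x - τ x) with hxm
  have hxp_τ : τ xp = sgnP true • xp := by
    rw [show sgnP true = 1 from rfl, one_smul, hxp, map_zsmul, map_add, hττ, add_comm (τ x) x]
  have hxm_τ : τ xm = sgnP false • xm := by
    rw [show sgnP false = -1 from rfl, neg_one_zsmul, hxm, map_zsmul, map_sub, hττ, ← neg_sub x (τ x), zsmul_neg]
  have hsum_pm : xp + xm = x := by
    have : u • (x + τ x) + u • (x - τ x) = (2 * u) • x := by
      rw [← zsmul_add, show x + τ x + (x - τ x) = x + x by abel, ← two_zsmul, smul_smul, mul_comm]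
    rw [hxp, hxm, this, hu x]
  have hxpR : R n w₁ xp := hRzsmul _ _ u _ (hRadd _ _ _ _ hxR (hRτ n q₁ w₁ x hw₁ hxR))
  have hxmR : R n w₁ xm := hRzsmul _ _ u _ (hRsub _ _ _ _ hxR (hRτ n q₁ w₁ x hw₁ hxR))
  obtain ⟨xS, xN, hxS_τ, hxN_τ, hxSR, -, hsumSN⟩ : ∃ xS xN : Vp W K p, τ xS = sgnP s₁ • xS ∧
      τ xN = sgnP (!s₁) • xN ∧ R n w₁ xS ∧ R n w₁ xN ∧ xS + xN = x := by
    cases s₁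
    · exact ⟨xm, xp, hxm_τ, hxp_τ, hxmR, hxpR, by rw [add_comm]; exact hsum_pm⟩
    · exact ⟨xp, xm, hxp_τ, hxm_τ, hxpR, hxmR, hsum_pm⟩
  have hxN0 : xN ∈ (W.baseChange K).torsionLocalKer (w₁.adicCompletion K) ((p ^ 1 : ℕ) : ℤ) :=
    hwrong (!s₁) xN (by cases s₁ <;> decide) hxN_τ
  have hxS0 : xS ∉ (W.baseChange K).torsionLocalKer (w₁.adicCompletion K) ((p ^ 1 : ℕ) : ℤ) := by
    intro h
    apply hxw₁
    rw [← hsumSN]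
    exact add_mem h hxN0
  -- `xS` is Kummer at `w₁` (toric would put it in `𝒮 (n ∪ q₁) m s₁ = 0`)
  have hxSK : xS ∈ selmerLocalKer (W.baseChange K) (w₁.adicCompletion K) ((p ^ 1 : ℕ) : ℤ) := by
    rcases hdich n q₁ w₁ hq₁ hw₁ xS hxSR with hK' | hT'
    · exact hK'
    · exfalso
      have hmem : xS ∈ 𝒮 (insert q₁ n) m s₁ := by
        refine (h𝒮 _ m s₁ xS).mpr ⟨hxS_τ, hxSR.1, fun v hvm hvn ↦ ?_, fun q hq v hv ↦ ?_, hxSR.2.2.2⟩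
        · have hvw : v ≠ w₁ := fun h ↦ hvn q₁ (Finset.mem_insert_self _ _) (by rw [h]; exact hw₁)
          exact hxSR.2.1 v hvw hvm (fun q hq ↦ hvn q (Finset.mem_insert_of_mem hq))
        · rcases Finset.mem_insert.mp hq with rfl | hq
          · rw [huniq _ w₁ v hw₁ hv]; exact hT'
          · exact hxSR.2.2.1 q hq v hv
      rw [hA s₁] at hmem
      have h0 : xS = 0 := (Submodule.mem_bot (ZMod p)).mp hmem
      rw [h0] at hxS0
      exact hxS0 (zero_mem _)
  have hxSmem : xS ∈ 𝒮 n m s₁ := by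
    refine (h𝒮 n m s₁ xS).mpr ⟨hxS_τ, hxSR.1, fun v hvm hvn ↦ ?_, hxSR.2.2.1, hxSR.2.2.2⟩
    by_cases hvw : v = w₁
    · rw [hvw]; exact hxSK
    · exact hxSR.2.1 v hvw hvm hvn
  have hxS_ne : xS ≠ 0 := fun h ↦ hxS0 (by rw [h]; exact zero_mem _)
  -- the Kummer line at `w₁` has `p` elements, so `𝒮 n m s₁ = 𝔽_p · xS`
  set loc₁ : Vp W K p →+ galoisCohomology (((W.baseChange K).torsionGaloisModule ((p ^ 1 : ℕ) : ℤ)).toLocal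
      (Sum.inr w₁)) 1 :=
    galoisCohomology.localization ((W.baseChange K).torsionGaloisModule ((p ^ 1 : ℕ) : ℤ)) (Sum.inr w₁) 1 with hloc₁
  set F₁ : AddSubgroup (galoisCohomology (((W.baseChange K).torsionGaloisModule ((p ^ 1 : ℕ) : ℤ)).toLocal
      (Sum.inr w₁)) 1) := (W.baseChange K).kummerSelmerStructure ((p ^ 1 : ℕ) : ℤ) (Sum.inr w₁) with hF₁
  have hF₁card : Nat.card F₁ = p := natCard_kummer_eq_of_admQ W K p hK q₁ w₁ hw₁
  have hmemF : ∀ y, y ∈ selmerLocalKer (W.baseChange K) (w₁.adicCompletion K) ((p ^ 1 : ℕ) : ℤ) → loc₁ y ∈ F₁ :=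
    fun y hy ↦ by
    rw [hF₁, WeierstrassCurve.kummerSelmerStructure_apply]
    exact (mem_selmerLocalKer_iff_localization_mem_kummer_P W K p w₁ y).mp hy
  have hker₁ : ∀ y, loc₁ y = 0 ↔ y ∈ (W.baseChange K).torsionLocalKer (w₁.adicCompletion K) ((p ^ 1 : ℕ) : ℤ) :=
    fun y ↦ (mem_torsionLocalKer_iff_localization_eq_zero_P W K p w₁ y).symm
  have hlocS : loc₁ xS ≠ 0 := fun h ↦ hxS0 ((hker₁ xS).mp h)
  have hgen : AddSubgroup.zmultiples (loc₁ xS) = F₁ :=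
    zmultiples_eq_of_card_prime F₁ hp hF₁card (hmemF xS hxSK) hlocS
  have hle : 𝒮 n m s₁ ≤ (ZMod p) ∙ xS := by
    intro y hy
    have hyK : y ∈ selmerLocalKer (W.baseChange K) (w₁.adicCompletion K) ((p ^ 1 : ℕ) : ℤ) :=
      ((h𝒮 n m s₁ y).mp hy).2.2.1 w₁ (fun ℓ _ ↦ hsepK q₁ ℓ w₁ hw₁)
        (fun q hq ↦ hsep q₁ q w₁ (fun h ↦ hq₁ (h ▸ hq)) hw₁)
    have hyF : loc₁ y ∈ AddSubgroup.zmultiples (loc₁ xS) := by rw [hgen]; exact hmemF y hyK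
    obtain ⟨k, hk⟩ := AddSubgroup.mem_zmultiples_iff.mp hyF
    have h0 : loc₁ (y - k • xS) = 0 := by rw [map_sub, map_zsmul, hk, sub_self]
    have hmem : y - k • xS ∈ 𝒮 n m s₁ := sub_mem hy (zsmul_mem hxSmem k)
    have hzero : y - k • xS = 0 := hB1 s₁ _ hmem ((hker₁ _).mp h0)
    rw [sub_eq_zero] at hzero
    rw [hzero, ← Int.cast_smul_eq_zsmul (ZMod p) k xS]
    exact Submodule.smul_mem _ _ (Submodule.mem_span_singleton_self xS)
  have hSeq : 𝒮 n m s₁ = (ZMod p) ∙ xS := le_antisymm hle ((Submodule.span_singleton_le_iff_mem xS _).mpr hxSmem)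
  have hfin1 : finrank (ZMod p) (𝒮 n m s₁) = 1 := by rw [hSeq, finrank_span_singleton hxS_ne]
  have hfin0 : ∀ μ', μ' ≠ s₁ → finrank (ZMod p) (𝒮 n m μ') = 0 := fun μ' hμ' ↦ by
    rw [hB2 μ' hμ', finrank_bot]
  cases s₁
  · have h0 := hfin0 true (by decide)
    omega
  · have h0 := hfin0 false (by decide)
    omega

end Summit.BirchSwinnertonDyer.BirchSwinnertonDyer.Theorems.AdditiveKoly

end
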